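import Mathlib
import Summits.Ventures.HodgeRepro2.T5CyclotomicSubfieldUnderDegree
import Summits.Ventures.HodgeRepro2.T5CyclotomicSubfieldInfinitude

/-!
# `Gal(F/ℚ) ≅ (ℤ/mℤ)ˣ / H_F`, AND INFINITELY MANY INERT PRIMES IN EVERY CYCLIC CM SUBFIELD OF `ℚ(ζₘ)`

Tier-5 support N3 / §G-N4.2 (seat p3, gen 81). For a subfield `F ⊆ ℚ(ζₘ)`:

* **`galEquivQuotient`**: `Gal(F/ℚ) ≃* (ℤ/mℤ)ˣ / H_F` (the restriction `Gal(ℚ(ζₘ)/ℚ) → Gal(F/ℚ)` is onto with kernel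
  `Gal(ℚ(ζₘ)/F)`, file 293; `galEquivZMod` carries it to `(ℤ/mℤ)ˣ / H_F`); `card_quotient`: `#((ℤ/mℤ)ˣ / H_F) = [F : ℚ]`;
  `isCyclic_quotient_of_isCyclic`: the quotient is cyclic when `Gal(F/ℚ)` is;
* **`exists_infinite_inert`** (`Gal(F/ℚ)` cyclic): there is a unit class `a mod m` — a generator of the quotient —
  such that EVERY prime `p ≡ a mod m` is INERT in `F` (`f(𝔭/p) = [F : ℚ]`, one prime of `F` above `p`), and there are
  infinitely many such primes (Dirichlet);
* **`exists_infinite_inert_sextic`** (`[F : ℚ] = 6`, `F` CM): infinitely many primes `p` with `f(𝔭/p) = 6`, `f(v/p) = 3`,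
  `N(v) = p³`, and the place `v` of `F⁺` under `𝔭` staying prime in `F` — the `q = p³` regime of the record's Satake chain
  is inhabited infinitely often on every sextic CM subfield of a cyclotomic field (files 282 / 295 / 300).

§8(d): uses an L-value-free non-vanishing device: NO.
-/

open NumberField NumberField.IsCMField IsCyclotomicExtension.Rat Ideal IsDedekindDomain
  IsDedekindDomain.HeightOneSpectrum
open Summit.Ventures.HodgeRepro2.T5CyclotomicSubfieldInertiaDeg
  Summit.Ventures.HodgeRepro2.T5CyclotomicSubfieldDecomposition
  Summit.Ventures.HodgeRepro2.T5CyclotomicSubfieldSatake Summit.Ventures.HodgeRepro2.T5CyclotomicSubfieldInfinitude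
  Summit.Ventures.HodgeRepro2.T5CyclotomicSubfieldUnderDegree

namespace Summit.Ventures.HodgeRepro2.T5CyclotomicSubfieldCyclicInert

section Quotient

variable (m : ℕ) [NeZero m] (L : Type*) [Field L] [NumberField L] [IsCyclotomicExtension {m} ℚ L]
  (F : IntermediateField ℚ L)

/-- The composite `(ℤ/mℤ)ˣ ≃* Gal(ℚ(ζₘ)/ℚ) →* Gal(F/ℚ)`. -/
noncomputable def toGal [Normal ℚ F] : (ZMod m)ˣ →* (F ≃ₐ[ℚ] F) :=
  (AlgEquiv.restrictNormalHom F).comp (galEquivZMod m L).symm.toMonoidHom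

/-- `toGal` is surjective. -/
theorem toGal_surjective [Normal ℚ F] : Function.Surjective (toGal m L F) := by
  haveI : IsGalois ℚ L := IsCyclotomicExtension.isGalois {m} ℚ L
  exact (AlgEquiv.restrictNormalHom_surjective (F := ℚ) (K₁ := F) (E := L)).comp
    (galEquivZMod m L).symm.surjective

/-- The kernel of `toGal` is `H_F`. -/
theorem ker_toGal [Normal ℚ F] : (toGal m L F).ker = zmodSubgroup m L F := by
  ext a
  rw [MonoidHom.mem_ker, mem_zmodSubgroup_iff, ← mem_ker_restrictNormalHom_iff, MonoidHom.mem_ker]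
  rfl

/-- **`Gal(F/ℚ) ≃* (ℤ/mℤ)ˣ / H_F`**. -/
noncomputable def galEquivQuotient [Normal ℚ F] : (F ≃ₐ[ℚ] F) ≃* (ZMod m)ˣ ⧸ zmodSubgroup m L F :=
  ((QuotientGroup.quotientKerEquivOfSurjective (toGal m L F) (toGal_surjective m L F)).symm.trans
    (QuotientGroup.quotientMulEquivOfEq (ker_toGal m L F)))

/-- `#((ℤ/mℤ)ˣ / H_F) = [F : ℚ]`. -/
theorem card_quotient : Nat.card ((ZMod m)ˣ ⧸ zmodSubgroup m L F) = Module.finrank ℚ F := by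
  haveI : IsGalois ℚ F := T5CyclotomicUnramified.isGalois_intermediateField L m F
  rw [← Nat.card_congr (galEquivQuotient m L F).toEquiv, IsGalois.card_aut_eq_finrank]

/-- `(ℤ/mℤ)ˣ / H_F` is cyclic when `Gal(F/ℚ)` is. -/
theorem isCyclic_quotient_of_isCyclic [IsCyclic (F ≃ₐ[ℚ] F)] :
    IsCyclic ((ZMod m)ˣ ⧸ zmodSubgroup m L F) := by
  haveI : IsGalois ℚ F := T5CyclotomicUnramified.isGalois_intermediateField L m F
  exact isCyclic_of_surjective (galEquivQuotient m L F) (galEquivQuotient m L F).surjective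

end Quotient

section Inert

variable (m : ℕ) [NeZero m] (L : Type*) [Field L] [NumberField L] [IsCyclotomicExtension {m} ℚ L]
  (F : IntermediateField ℚ L)

/-- **A generator class and its primes are inert** (`Gal(F/ℚ)` cyclic): for a unit `a mod m` generating
`(ℤ/mℤ)ˣ / H_F`, every prime `p ≡ a mod m` has `f(𝔭/p) = [F : ℚ]` and exactly one prime of `F` above it. -/
theorem exists_infinite_inert [IsCyclic (F ≃ₐ[ℚ] F)] :
    ∃ a : (ZMod m)ˣ, {p : ℕ | p.Prime ∧ (p : ZMod m) = a}.Infinite ∧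
      ∀ (p : ℕ) [Fact p.Prime] (_hpm : p.Coprime m), (p : ZMod m) = a →
        ∀ (𝔭 : Ideal (𝓞 F)) [𝔭.IsPrime] [𝔭.LiesOver (span {(p : ℤ)})],
          𝔭.inertiaDeg ℤ = Module.finrank ℚ F ∧ ((span {(p : ℤ)}).primesOver (𝓞 F)).ncard = 1 := by
  haveI := isCyclic_quotient_of_isCyclic m L F
  obtain ⟨g, hg⟩ := IsCyclic.exists_generator (α := (ZMod m)ˣ ⧸ zmodSubgroup m L F)
  obtain ⟨a, rfl⟩ := QuotientGroup.mk_surjective g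
  have hord : orderOf (QuotientGroup.mk a : (ZMod m)ˣ ⧸ zmodSubgroup m L F) = Module.finrank ℚ F := by
    rw [orderOf_eq_card_of_forall_mem_zpowers hg, card_quotient]
  refine ⟨a, Nat.infinite_setOf_prime_and_eq_mod a.isUnit, fun p _ hpm hpa 𝔭 _ _ => ?_⟩
  have hu : ZMod.unitOfCoprime p hpm = a := by
    rw [Units.ext_iff, ZMod.coe_unitOfCoprime, hpa]
  have hf : 𝔭.inertiaDeg ℤ = Module.finrank ℚ F := by
    rw [inertiaDeg_eq_orderOf_mk m L F p hpm 𝔭, hu, hord]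
  refine ⟨hf, ?_⟩
  have h := T5CyclotomicUnramified.ncard_primesOver_mul_inertiaDeg p L F
    ((Nat.Prime.coprime_iff_not_dvd (Fact.out)).mp hpm) 𝔭
  rw [hf] at h
  have hpos : 0 < Module.finrank ℚ F := Module.finrank_pos
  exact Nat.eq_of_mul_eq_mul_right hpos (by simpa using h)

variable [IsCMField L] [IsCMField F]

/-- **THE SEXTIC CASE: INFINITELY MANY PLACES WITH `q = p³`**. For a sextic CM subfield `F ⊆ ℚ(ζₘ)` there is a unit
class `a mod m` with infinitely many primes, such that every prime `p ≡ a mod m` has `f(𝔭/p) = 6`, the place `v` of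
`F⁺` under `𝔭` stays prime in `F` with `f(v/p) = 3` and `N(v) = p³`. -/
theorem exists_infinite_inert_sextic (h6 : Module.finrank ℚ F = 6) :
    ∃ a : (ZMod m)ˣ, {p : ℕ | p.Prime ∧ (p : ZMod m) = a}.Infinite ∧
      ∀ (p : ℕ) [Fact p.Prime] (_hpm : p.Coprime m), (p : ZMod m) = a →
        ∀ (𝔭 : Ideal (𝓞 F)) [𝔭.IsPrime] [𝔭.LiesOver (span {(p : ℤ)})]
          (v : HeightOneSpectrum (𝓞 (maximalRealSubfield F))) [𝔭.LiesOver v.asIdeal],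
          𝔭.inertiaDeg ℤ = 6 ∧ v.asIdeal.inertiaDeg ℤ = 3 ∧ Ideal.absNorm v.asIdeal = p ^ 3 ∧
            ∃ w : HeightOneSpectrum (𝓞 F),
              Ideal.map (algebraMap (𝓞 (maximalRealSubfield F)) (𝓞 F)) v.asIdeal = w.asIdeal := by
  haveI : IsGalois ℚ F := T5CyclotomicUnramified.isGalois_intermediateField L m F
  haveI : IsCyclic (F ≃ₐ[ℚ] F) := T5CMFieldCyclicGaloisCriterion.isCyclic_gal F h6
  obtain ⟨a, hinf, ha⟩ := exists_infinite_inert m L F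
  refine ⟨a, hinf, fun p _ hpm hpa 𝔭 _ _ v _ => ?_⟩
  obtain ⟨hf, -⟩ := ha p hpm hpa 𝔭
  rw [h6] at hf
  have hmem : (QuotientGroup.mk (-1) : (ZMod m)ˣ ⧸ zmodSubgroup m L F) ∈
      Subgroup.zpowers (QuotientGroup.mk (ZMod.unitOfCoprime p hpm)) := by
    rw [← ncard_primesOver_eq_one_iff_mem_zpowers' m L F p hpm 𝔭 v]
    have he : 𝔭.ramificationIdx ℤ = 1 :=
      T5CyclotomicUnramified.ramificationIdx_eq_one p L F
        ((Nat.Prime.coprime_iff_not_dvd (Fact.out)).mp hpm) 𝔭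
    exact (T5CMFieldCyclicGaloisCriterion.ncard_primesOver_eq_one_iff_even_inertiaDeg F p 𝔭 v he).mpr
      (by rw [hf]; decide)
  have h2 := two_mul_inertiaDeg_eq_orderOf_mk m L F p hpm 𝔭 v hmem
  rw [← inertiaDeg_eq_orderOf_mk m L F p hpm 𝔭, hf] at h2
  have hv : v.asIdeal.inertiaDeg ℤ = 3 := by omega
  haveI : v.asIdeal.LiesOver (span {(p : ℤ)}) := Ideal.LiesOver.tower_bot 𝔭 v.asIdeal _
  refine ⟨hf, hv, ?_, (exists_map_eq_iff_mem_zpowers m L F p hpm 𝔭 v).mpr hmem⟩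
  rw [T5SexticRecordSatake.absNorm_eq_pow_inertiaDeg F p v, hv]

end Inert

end Summit.Ventures.HodgeRepro2.T5CyclotomicSubfieldCyclicInert
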